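import Summits.AnomalousDissipation.AnomalousDissipation.Theorems.QuarticTightness.Negative.Anatomy
import Summits.AnomalousDissipation.AnomalousDissipation.Theorems.MomentParityGalerkinLiouville

/-!
# Stub `stub_meanZeroFlow` (S2) of the line `horizon-shooting` (payload `Ideate3Sketch`)
# for the crux `MomentParity.QuarticTightness` (stmt-AnomalousDissipation-14331)

Sorry-free discharge of the registered stub `stub_meanZeroFlow` of the lead's skeleton: the
level-`N` Galerkin semiflow `Torus.galerkinFlow ν f N` of the Navier–Stokes equations on `T³`
with a mean-zero force `f` PRESERVES ZERO MEAN on Galerkin modes.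

**Proof.** On a Galerkin mode `a` the slice at time `t` is the real trigonometric polynomial
`realTrigPoly (freqBall N) (coeffExt (freqBall N) (α t))` of the coefficient orbit
`α t := galerkinCoeffFlow ν (f̂|_{≤N}) t (â|_{≤N})` (`IsGalerkinMode.galerkinFlow_eq`); a real
trigonometric polynomial whose coefficient at the frequency `0` vanishes has zero mean
(`∫ e_k = δ_{k0}`). The mean mode `t ↦ α t 0` of the orbit has right derivative
`galerkinRHS (freqBall N) ν (f̂|_{≤N}) (α t) 0 = 0` on `[0, ∞)` (the orbit solves the Galerkin ODE,
`isGalerkinODESolution_galerkinCoeffFlow`; the Galerkin field of a mean-zero force has no mean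
mode on the phase space, `MomentParity.galerkinRHS_apply_zero`), hence is constant on `[0, t]`
(`constant_of_has_deriv_right_zero`) and equals `α 0 0 = â(0) = 0` because `∫ a = 0`.

References: Constantin–Foias, *Navier–Stokes Equations* (Chicago 1988), Ch. 8, (8.5)–(8.6);
Robinson–Rodrigo–Sadowski, *The three-dimensional Navier–Stokes equations* (CUP 2016), §4.1.
-/

open MeasureTheory Filter Topology Set
open scoped ENNReal InnerProductSpace RealInnerProductSpace
open Literature.Analysis.FunctionSpaces Literature.Analysis.FluidPDE
open Summit.AnomalousDissipation.AnomalousDissipation.Theorems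
open Summit.AnomalousDissipation.AnomalousDissipation.Theorems.QuarticGate.Negative
-- `T3 = UnitAddTorus (Fin 3)`, `R3 = EuclideanSpace ℝ (Fin 3)`, `H3 = ↥(Torus.energySpace (Fin 3))`
open Summit.AnomalousDissipation.AnomalousDissipation.Theorems.CubicParityLoud.Negative (T3 R3 H3 L2T3)
set_option linter.dupNamespace false
noncomputable section

namespace Summit.AnomalousDissipation.AnomalousDissipation.Theorems.MomentParityQuarticTightness

/-- A real trigonometric polynomial whose coefficient at the frequency `0` vanishes has zero
mean: `∫ realTrigPoly S c = Re ∑_{k ∈ S} (∫ e_k) c k = Re (c 0 · [0 ∈ S]) = 0`. [folklore] -/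
private theorem hasZeroMean_realTrigPoly_of_coeff_zero {d : Type*} [Fintype d]
    (S : Finset (d → ℤ)) {c : (d → ℤ) → EuclideanSpace ℂ d} (hc0 : c 0 = 0) :
    Torus.HasZeroMean (Torus.realTrigPoly S c) := by
  unfold Torus.HasZeroMean
  simp_rw [Torus.realTrigPoly_apply_eq_sum]
  rw [integral_finsetSum _ fun k _ => ?_]
  · refine Finset.sum_eq_zero fun k _ => ?_
    have hi : Integrable (fun x : UnitAddTorus d => UnitAddTorus.mFourier k x • c k) volume :=
      ((UnitAddTorus.mFourier k).continuous.smul continuous_const).integrable_unitAddTorus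
    rw [ContinuousLinearMap.integral_comp_comm _ hi, integral_smul_const, Torus.integral_mFourier]
    by_cases hk : k = 0
    · subst hk; simp [hc0]
    · rw [if_neg hk, zero_smul, map_zero]
  · exact (EuclideanSpace.realPart.continuous.comp
      ((UnitAddTorus.mFourier k).continuous.smul continuous_const)).integrable_unitAddTorus

/-- **S2 — THE GALERKIN SEMIFLOW PRESERVES ZERO MEAN.** For `ν ≥ 0`, a smooth mean-zero force
`f` and a mean-zero Galerkin mode `a` of order `N`, every forward slice
`Torus.galerkinFlow ν f N t a` (`t ≥ 0`) of the level-`N` Galerkin orbit has zero mean: the mean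
mode of the coefficient orbit has derivative `galerkinRHS … 0 = 0`
(`MomentParity.galerkinRHS_apply_zero`), so it keeps its initial value `â(0) = 0`. [folklore;
Constantin–Foias 1988, Ch. 8] -/
theorem stub_meanZeroFlow (ν : ℝ) (f : T3 → R3) (N : ℕ) (a : T3 → R3) (hν : 0 ≤ ν)
    (hf : Torus.IsSmooth f) (hfz : Torus.HasZeroMean f) (ha : IsGalerkinMode N a)
    (ha0 : Torus.HasZeroMean a) (t : ℝ) (ht : 0 ≤ t) :
    Torus.HasZeroMean (Torus.galerkinFlow ν f N t a) := by
  rw [ha.galerkinFlow_eq t]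
  refine hasZeroMean_realTrigPoly_of_coeff_zero _ ?_
  rw [Torus.coeffExt_of_mem _ (Torus.zero_mem_freqBall N)]
  -- the coefficient orbit `s ↦ φ_s (â|_{≤N})` solves the Galerkin ODE with force `f̂|_{≤N}`
  set g : ↥(Torus.freqBall (d := Fin 3) N) → EuclideanSpace ℂ (Fin 3) :=
    fourierRestrict (Torus.freqBall N) f with hg
  set c₀ : ↥(Torus.freqBall (d := Fin 3) N) → EuclideanSpace ℂ (Fin 3) :=
    fourierRestrict (Torus.freqBall N) a with hc₀
  have hfi : Integrable f volume := hf.integrable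
  have hsol : IsGalerkinODESolution ν g c₀ fun s => galerkinCoeffFlow ν g s c₀ :=
    isGalerkinODESolution_galerkinCoeffFlow hν Torus.neg_mem_freqBall_of_mem
      (Torus.isRealCoeff_mFourierCoeff hfi) ha.fourierRestrict_mem
  -- its mean mode has vanishing right derivative on `[0, ∞)` ...
  have hderiv : ∀ s ∈ Ico 0 t, HasDerivWithinAt
      (fun s => galerkinCoeffFlow ν g s c₀ ⟨0, Torus.zero_mem_freqBall N⟩) 0 (Ici s) s := by
    intro s hs
    have h : HasDerivWithinAt (fun s => galerkinCoeffFlow ν g s c₀ ⟨0, Torus.zero_mem_freqBall N⟩)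
        (galerkinRHS (Torus.freqBall N) ν g (galerkinCoeffFlow ν g s c₀)
          ⟨0, Torus.zero_mem_freqBall N⟩) (Ici s) s :=
      hasDerivWithinAt_pi.1 (hsol.hasDerivWithinAt_Ici hs) _
    exact h.congr_deriv (MomentParity.galerkinRHS_apply_zero ν hfi hfz
      (galerkinCoeffFlow_mem ha.fourierRestrict_mem s))
  -- ... and is continuous on `[0, t]`, hence constant there
  have hcont : ContinuousOn
      (fun s => galerkinCoeffFlow ν g s c₀ ⟨0, Torus.zero_mem_freqBall N⟩) (Icc 0 t) :=
    ((continuous_apply _).comp_continuousOn hsol.continuousOn).mono Icc_subset_Ici_self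
  rw [constant_of_has_deriv_right_zero hcont hderiv t (right_mem_Icc.2 ht), galerkinCoeffFlow_zero,
    hc₀, fourierRestrict_apply]
  -- the initial mean mode is `â(0) = 0`
  exact Torus.mFourierCoeff_complexify_zero_of_hasZeroMean ha.isSmooth.integrable ha0

end Summit.AnomalousDissipation.AnomalousDissipation.Theorems.MomentParityQuarticTightness

end
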